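import Summits.QuantumFields.BalabanUV.T4Continuum.Support.NE7CurvedPlaquetteFactorisation
import Summits.QuantumFields.BalabanUV.T4Continuum.Support.NE7GradientCurrency
import Summits.QuantumFields.BalabanUV.T4Continuum.Support.AveragingDeficitTransport
import Summits.QuantumFields.BalabanUV.T4Continuum.Support.NE3EnergyShapes
import HarnessLib

/-!
# NE7GaugeStepCurlCovariance — THE CURVED CURL LETTER OF ONE GAUGE STEP (memo ROAD-G100 §2.3 (c), «the multiplicative point»): if two representatives `X⁰, X¹` of the chart at a
# unitary background `W` are related by a unitary gauge `g` (`W·e^{X¹} = (W·e^{X⁰})^{g}`), then AT EVERY PLAQUETTE the dressed curls differ by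
# `‖curl_W X¹(p) − curl_W X⁰(p)‖ ≤ 2‖g(z_p) − 1‖·‖(W e^{X⁰})(∂p) − 1‖ + (e^{4ρ} − 1)·Σ_{b ⊂ ∂p}‖X¹(b) − X⁰(b)‖` — the relative plaquette variable is CONJUGATED
# (`Ad_{g(z_p)}`), so only the gauge's distance from `1` at ONE site times the plaquette deviation enters, plus the Lipschitz letter of the second-order remainder; NO lattice
# difference of the junk `X¹ − X⁰` appears

Cell `pub-balaban`, rung (B)+1 sub-cell t4, lineage `b2b-balaban-t4-ne7-p1`, generation 100 (CRUX PROVER NE7 #1 = OWNER of BINDER row NE7).  Memo `t4/b2b-balaban-t4-ne7-p1-g100/ROAD-G100.md`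
§2.3 (c) ∕ §3 (iii): the one-step letters of the (S1) iteration are gen 74's `NE7GaugeStepDeviation` (FLAT background) and gen 95's `NE7GaugeStepResidue.norm_gaugeStep_residue_le` (curved, the
BCH∕value letter); THIS FILE is the missing curved CURL letter, over gen 79's factorisation `NE7CurvedPlaquetteFactorisation.curlAt_eq_relPlaq_sub_rem` (`curl_W X(p) = [(W e^{X})(∂p)·W(∂p)⁻¹ − 1]
− Rem(X₁,…,X₄)`), lit-balaban's gauge covariance of closed holonomies `B7Prop1Explicit.hol_gaugeAct_closed`, `AveragingDeficitNearIdentity.norm_Ad_sub_le` (`‖Ad_u A − A‖ ≤ 2‖u − 1‖‖A‖`) and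
gen 74's Lipschitz letter of the remainder `NE7GradientCurrency.norm_plaqRem_sub_plaqRem_le` — all BY NAME.
WHAT ([folklore]; 0 def, 0 sorry; every `d`, every unitary `W`, every unitary site gauge `g`).
§1 **`hol_vary_plaqWord_of_gaugeAct`**: `vary W X¹ 1 = gaugeAct g (vary W X⁰ 1)` ⟹ `(W e^{X¹})(∂p) = Ad_{g(z)}((W e^{X⁰})(∂p))`.
§2 **`norm_relPlaq_sub_relPlaq_le`**: the relative plaquette deviations `Q^i := (W e^{X^i})(∂p)·W(∂p)⁻¹ − 1` satisfy `‖Q¹ − Q⁰‖ ≤ 2‖g(z) − 1‖·‖(W e^{X⁰})(∂p) − 1‖`.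
§3 **`norm_curlAt_sub_curlAt_le_of_gaugeAct`**: `‖curlAt W X¹ z μ ν − curlAt W X⁰ z μ ν‖ ≤ 2‖g(z) − 1‖·‖(W e^{X⁰})(∂p) − 1‖ + (e^{4ρ} − 1)·(‖D(z,μ)‖ + ‖D(z+e_μ,ν)‖ + ‖D(z+e_ν,μ)‖ + ‖D(z,ν)‖)`,
   `D := X¹ − X⁰`, `ρ ≥` the eight bond norms of `X⁰, X¹` around `p`; **`norm_curlAt_sub_curlAt_le_of_gaugeAct_smallField`**: with `SmallField (vary W X⁰ 1) x′`, `‖g(y) − 1‖ ≤ γ`,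
   `‖X^i‖ ≤ ρ`, `‖X¹ − X⁰‖ ≤ η` everywhere and `μ ≠ ν`: `≤ 2γx′ + 4(e^{4ρ} − 1)η`; **`norm_curl_sub_curl_le_of_gaugeAct_smallField`** (the same on indexed plaquettes `p : Plaq d`).
HOW IT IS CONSUMED (memo §2.3): in the (S1) iteration `X¹ = X(step u)`, `X⁰ = X(u)`, `g = e^{−ζ(u)}` (`γ ≤ 2σ`), `x′ ≤ ε₁∕M²` (the pair's plaquettes, gauge invariant: `smallField_gaugeAct`),
`η ≤ δ + ‖J‖`; together with `NE3CurlReverseReading.norm_curlAt_le_of_vary` (the curl of ANY representative is `≤` plaquette deviation `+ O(ρ²)`) this is why the defect recursion closes in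
sup norm alone.
HONEST FRAMING (page 1): pointwise matrix∕lattice algebra at ONE configuration; nothing of Bałaban's asserted; NOT the iteration, NOT (S1), NOT NE7; spine 0∕9; finite T⁴ rung (B)+1 — NOT
infinite volume, NOT mass gap, NOT BetaPertH, NOT Clay.  Continuum YM on T⁴ ⇐ BetaPertH ∧ nine spine estimates (0/9 proved); BetaPertH ⇐ (D1) ∧ (D4) ∧ CAP+tail; G-an2-4 gates asym,
D1 and NE2/3/4.
-/

set_option autoImplicit false

open scoped BigOperators Matrix Matrix.Norms.L2Operator
open NormedSpace Finset

namespace Summit.QuantumFields.BalabanUV.T4Continuum.NE7GaugeStepCurlCovariance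

open Literature.MathematicalPhysics.QuantumFieldTheory.Balaban1983to89
open B7Prop1Explicit B7Prop2Explicit MatrixLog UnitaryModel
open T4AveragingDeficitWall (Ad IsUnitaryCfg SmallField vary curlAt curl)
open T4AveragingDeficitNonAbelian (Ad_sub)
open AveragingDeficitTransport (norm_Ad_of_unitary)
open AveragingDeficitNearIdentity (norm_Ad_sub_le)
open SkeletonPrecompTools (Ad_apply_one)
open NE3EnergyShapes (IsUnitarySite)
open NE7GradientCurrency (norm_plaqRem_sub_plaqRem_le)
open NE7CurvedPlaquetteFactorisation (curlAt_eq_relPlaq_sub_rem)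

noncomputable section

variable {d : ℕ} {n : Type*} [Fintype n] [DecidableEq n]

/-! ## §1 The perturbed plaquette variable is conjugated by the gauge -/

/-- **`(W e^{X¹})(∂p) = Ad_{g(z)}((W e^{X⁰})(∂p))`** when `W·e^{X¹} = (W·e^{X⁰})^{g}` (closed contour; `B7Prop1Explicit.hol_gaugeAct_closed`). [folklore] -/
theorem hol_vary_plaqWord_of_gaugeAct (W : Site d → Fin d → (Matrix n n ℂ)ˣ) (g : Site d → (Matrix n n ℂ)ˣ) (X₀ X₁ : Site d → Fin d → Matrix n n ℂ)
    (hg : vary W X₁ 1 = gaugeAct g (vary W X₀ 1)) (z : Site d) (μ ν : Fin d) :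
    ((hol (vary W X₁ 1) z (plaqWord μ ν) : (Matrix n n ℂ)ˣ) : Matrix n n ℂ) = Ad (g z) ((hol (vary W X₀ 1) z (plaqWord μ ν) : (Matrix n n ℂ)ˣ) : Matrix n n ℂ) := by
  rw [hg, hol_gaugeAct_closed _ _ _ _ (disp_plaqWord μ ν), Units.val_mul, Units.val_mul]
  rfl

/-! ## §2 The relative plaquette deviation moves by `2‖g − 1‖·‖(W e^{X⁰})(∂p) − 1‖` -/

/-- **`‖Q¹ − Q⁰‖ ≤ 2‖g(z) − 1‖·‖(W e^{X⁰})(∂p) − 1‖`** for the relative plaquette deviations `Q^i = (W e^{X^i})(∂p)·W(∂p)⁻¹ − 1` (`W` unitary, `g` unitary):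
`Q¹ − Q⁰ = [Ad_g(H⁰ − 1) − (H⁰ − 1)]·W(∂p)⁻¹`, `‖Ad_g A − A‖ ≤ 2‖g − 1‖‖A‖`, `‖W(∂p)⁻¹‖ = 1`. [folklore] -/
theorem norm_relPlaq_sub_relPlaq_le [Nonempty n] {W : Site d → Fin d → (Matrix n n ℂ)ˣ} (hW : IsUnitaryCfg W) {g : Site d → (Matrix n n ℂ)ˣ} (hgu : IsUnitarySite g)
    {X₀ X₁ : Site d → Fin d → Matrix n n ℂ} (hg : vary W X₁ 1 = gaugeAct g (vary W X₀ 1)) (z : Site d) (μ ν : Fin d) :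
    ‖(((hol (vary W X₁ 1) z (plaqWord μ ν) : (Matrix n n ℂ)ˣ) : Matrix n n ℂ) * (((hol W z (plaqWord μ ν))⁻¹ : (Matrix n n ℂ)ˣ) : Matrix n n ℂ) - 1)
        - (((hol (vary W X₀ 1) z (plaqWord μ ν) : (Matrix n n ℂ)ˣ) : Matrix n n ℂ) * (((hol W z (plaqWord μ ν))⁻¹ : (Matrix n n ℂ)ˣ) : Matrix n n ℂ) - 1)‖
      ≤ 2 * ‖((g z : (Matrix n n ℂ)ˣ) : Matrix n n ℂ) - 1‖ * ‖((hol (vary W X₀ 1) z (plaqWord μ ν) : (Matrix n n ℂ)ˣ) : Matrix n n ℂ) - 1‖ := by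
  set H₀ : Matrix n n ℂ := ((hol (vary W X₀ 1) z (plaqWord μ ν) : (Matrix n n ℂ)ˣ) : Matrix n n ℂ) with hH₀
  set Pi : Matrix n n ℂ := (((hol W z (plaqWord μ ν))⁻¹ : (Matrix n n ℂ)ˣ) : Matrix n n ℂ) with hPi
  have hP : hol W z (plaqWord μ ν) ∈ unitaryUnits (Matrix n n ℂ) := hol_mem_of hW _ _
  have hPi1 : ‖Pi‖ ≤ 1 :=
    (CStarRing.norm_of_mem_unitary (mem_unitaryUnits.mp ((unitaryUnits (Matrix n n ℂ)).inv_mem hP))).le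
  rw [hol_vary_plaqWord_of_gaugeAct W g X₀ X₁ hg z μ ν]
  have e : (Ad (g z) H₀ * Pi - 1) - (H₀ * Pi - 1) = (Ad (g z) (H₀ - 1) - (H₀ - 1)) * Pi := by
    rw [Ad_sub, Ad_apply_one]; noncomm_ring
  rw [e]
  calc ‖(Ad (g z) (H₀ - 1) - (H₀ - 1)) * Pi‖ ≤ ‖Ad (g z) (H₀ - 1) - (H₀ - 1)‖ * ‖Pi‖ := norm_mul_le _ _
    _ ≤ (2 * ‖((g z : (Matrix n n ℂ)ˣ) : Matrix n n ℂ) - 1‖ * ‖H₀ - 1‖) * 1 :=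
        mul_le_mul (norm_Ad_sub_le (hgu z) _) hPi1 (norm_nonneg _) (by positivity)
    _ = 2 * ‖((g z : (Matrix n n ℂ)ˣ) : Matrix n n ℂ) - 1‖ * ‖H₀ - 1‖ := mul_one _

/-! ## §3 The curl letter of one gauge step -/

/-- **THE CURVED CURL LETTER OF ONE GAUGE STEP**: for `W` unitary, `g` a unitary site gauge with `W·e^{X¹} = (W·e^{X⁰})^{g}`, and `ρ` bounding the eight bond values of `X⁰, X¹` around the
plaquette `p = (z; μ, ν)`:
`‖curlAt W X¹ z μ ν − curlAt W X⁰ z μ ν‖ ≤ 2‖g(z) − 1‖·‖(W e^{X⁰})(∂p) − 1‖ + (e^{4ρ} − 1)·(‖D z μ‖ + ‖D (z+e_μ) ν‖ + ‖D (z+e_ν) μ‖ + ‖D z ν‖)`, `D = X¹ − X⁰`. [folklore] -/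
theorem norm_curlAt_sub_curlAt_le_of_gaugeAct [Nonempty n] {W : Site d → Fin d → (Matrix n n ℂ)ˣ} (hW : IsUnitaryCfg W) {g : Site d → (Matrix n n ℂ)ˣ} (hgu : IsUnitarySite g)
    {X₀ X₁ : Site d → Fin d → Matrix n n ℂ} (hg : vary W X₁ 1 = gaugeAct g (vary W X₀ 1)) (z : Site d) (μ ν : Fin d) {ρ : ℝ}
    (h₀₁ : ‖X₀ z μ‖ ≤ ρ) (h₀₂ : ‖X₀ (z + e μ) ν‖ ≤ ρ) (h₀₃ : ‖X₀ (z + e ν) μ‖ ≤ ρ) (h₀₄ : ‖X₀ z ν‖ ≤ ρ)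
    (h₁₁ : ‖X₁ z μ‖ ≤ ρ) (h₁₂ : ‖X₁ (z + e μ) ν‖ ≤ ρ) (h₁₃ : ‖X₁ (z + e ν) μ‖ ≤ ρ) (h₁₄ : ‖X₁ z ν‖ ≤ ρ) :
    ‖curlAt W X₁ z μ ν - curlAt W X₀ z μ ν‖
      ≤ 2 * ‖((g z : (Matrix n n ℂ)ˣ) : Matrix n n ℂ) - 1‖ * ‖((hol (vary W X₀ 1) z (plaqWord μ ν) : (Matrix n n ℂ)ˣ) : Matrix n n ℂ) - 1‖
        + (Real.exp (4 * ρ) - 1) * (‖X₁ z μ - X₀ z μ‖ + ‖X₁ (z + e μ) ν - X₀ (z + e μ) ν‖ + ‖X₁ (z + e ν) μ - X₀ (z + e ν) μ‖ + ‖X₁ z ν - X₀ z ν‖) := by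
  letI : CStarAlgebra (Matrix n n ℂ) := {}
  letI : NormedAlgebra ℚ (Matrix n n ℂ) := NormedAlgebra.restrictScalars ℚ ℝ (Matrix n n ℂ)
  -- the unitary transports of the four terms
  have h1 : W z μ ∈ unitaryUnits (Matrix n n ℂ) := hW _ _
  have h12 : W z μ * W (z + e μ) ν ∈ unitaryUnits (Matrix n n ℂ) := (unitaryUnits _).mul_mem (hW _ _) (hW _ _)
  have h123 : W z μ * W (z + e μ) ν * (W (z + e ν) μ)⁻¹ ∈ unitaryUnits (Matrix n n ℂ) := (unitaryUnits _).mul_mem h12 ((unitaryUnits _).inv_mem (hW _ _))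
  -- the two decompositions `curl = relPlaq − Rem`
  rw [curlAt_eq_relPlaq_sub_rem W X₁ z μ ν, curlAt_eq_relPlaq_sub_rem W X₀ z μ ν]
  have eq : ∀ (a₁ r₁ a₀ r₀ : Matrix n n ℂ), (a₁ - r₁) - (a₀ - r₀) = (a₁ - a₀) - (r₁ - r₀) := fun _ _ _ _ => by abel
  rw [eq]
  refine (norm_sub_le _ _).trans (add_le_add (norm_relPlaq_sub_relPlaq_le hW hgu hg z μ ν) ?_)
  -- the Lipschitz letter of the remainder with the transported exponents
  have hx₁ : ‖Ad (W z μ) (X₁ z μ)‖ ≤ ρ := by rw [norm_Ad_of_unitary h1]; exact h₁₁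
  have hx₂ : ‖Ad (W z μ * W (z + e μ) ν) (X₁ (z + e μ) ν)‖ ≤ ρ := by rw [norm_Ad_of_unitary h12]; exact h₁₂
  have hx₃ : ‖-Ad (W z μ * W (z + e μ) ν) (X₁ (z + e ν) μ)‖ ≤ ρ := by rw [norm_neg, norm_Ad_of_unitary h12]; exact h₁₃
  have hx₄ : ‖-Ad (W z μ * W (z + e μ) ν * (W (z + e ν) μ)⁻¹) (X₁ z ν)‖ ≤ ρ := by rw [norm_neg, norm_Ad_of_unitary h123]; exact h₁₄
  have hy₁ : ‖Ad (W z μ) (X₀ z μ)‖ ≤ ρ := by rw [norm_Ad_of_unitary h1]; exact h₀₁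
  have hy₂ : ‖Ad (W z μ * W (z + e μ) ν) (X₀ (z + e μ) ν)‖ ≤ ρ := by rw [norm_Ad_of_unitary h12]; exact h₀₂
  have hy₃ : ‖-Ad (W z μ * W (z + e μ) ν) (X₀ (z + e ν) μ)‖ ≤ ρ := by rw [norm_neg, norm_Ad_of_unitary h12]; exact h₀₃
  have hy₄ : ‖-Ad (W z μ * W (z + e μ) ν * (W (z + e ν) μ)⁻¹) (X₀ z ν)‖ ≤ ρ := by rw [norm_neg, norm_Ad_of_unitary h123]; exact h₀₄
  have hL := norm_plaqRem_sub_plaqRem_le hx₁ hx₂ hx₃ hx₄ hy₁ hy₂ hy₃ hy₄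
  -- the differences of the transported exponents are the transports of the differences
  have d₁ : ‖Ad (W z μ) (X₁ z μ) - Ad (W z μ) (X₀ z μ)‖ = ‖X₁ z μ - X₀ z μ‖ := by rw [← Ad_sub, norm_Ad_of_unitary h1]
  have d₂ : ‖Ad (W z μ * W (z + e μ) ν) (X₁ (z + e μ) ν) - Ad (W z μ * W (z + e μ) ν) (X₀ (z + e μ) ν)‖ = ‖X₁ (z + e μ) ν - X₀ (z + e μ) ν‖ := by
    rw [← Ad_sub, norm_Ad_of_unitary h12]
  have d₃ : ‖-Ad (W z μ * W (z + e μ) ν) (X₁ (z + e ν) μ) - -Ad (W z μ * W (z + e μ) ν) (X₀ (z + e ν) μ)‖ = ‖X₁ (z + e ν) μ - X₀ (z + e ν) μ‖ := by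
    rw [neg_sub_neg, ← Ad_sub, norm_Ad_of_unitary h12, norm_sub_rev]
  have d₄ : ‖-Ad (W z μ * W (z + e μ) ν * (W (z + e ν) μ)⁻¹) (X₁ z ν) - -Ad (W z μ * W (z + e μ) ν * (W (z + e ν) μ)⁻¹) (X₀ z ν)‖ = ‖X₁ z ν - X₀ z ν‖ := by
    rw [neg_sub_neg, ← Ad_sub, norm_Ad_of_unitary h123, norm_sub_rev]
  rw [d₁, d₂, d₃, d₄] at hL
  exact hL

/-- **THE CURVED CURL LETTER OF ONE GAUGE STEP, SMALL-FIELD∕SUP FORM** (the shape the (S1) recursion consumes): `W` unitary, the perturbed configuration `W·e^{X⁰}` in the small-field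
class `SmallField (vary W X⁰ 1) x′`, `g` a unitary site gauge with `‖g(y) − 1‖ ≤ γ` and `W·e^{X¹} = (W·e^{X⁰})^{g}`, `‖X⁰‖, ‖X¹‖ ≤ ρ` and `‖X¹ − X⁰‖ ≤ η` on every bond; then on every
plaquette `(z; μ ≠ ν)`: `‖curlAt W X¹ z μ ν − curlAt W X⁰ z μ ν‖ ≤ 2γ·x′ + 4(e^{4ρ} − 1)·η`. [folklore] -/
theorem norm_curlAt_sub_curlAt_le_of_gaugeAct_smallField [Nonempty n] {W : Site d → Fin d → (Matrix n n ℂ)ˣ} (hW : IsUnitaryCfg W) {g : Site d → (Matrix n n ℂ)ˣ}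
    (hgu : IsUnitarySite g) {X₀ X₁ : Site d → Fin d → Matrix n n ℂ} (hg : vary W X₁ 1 = gaugeAct g (vary W X₀ 1)) {x' γ ρ η : ℝ}
    (hx' : SmallField (vary W X₀ 1) x') (hγ : ∀ y, ‖((g y : (Matrix n n ℂ)ˣ) : Matrix n n ℂ) - 1‖ ≤ γ)
    (hρ₀ : ∀ y κ, ‖X₀ y κ‖ ≤ ρ) (hρ₁ : ∀ y κ, ‖X₁ y κ‖ ≤ ρ) (hη : ∀ y κ, ‖X₁ y κ - X₀ y κ‖ ≤ η)
    (z : Site d) {μ ν : Fin d} (hμν : μ ≠ ν) :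
    ‖curlAt W X₁ z μ ν - curlAt W X₀ z μ ν‖ ≤ 2 * γ * x' + 4 * (Real.exp (4 * ρ) - 1) * η := by
  have hρ : 0 ≤ ρ := (norm_nonneg _).trans (hρ₀ z μ)
  have hexp : 0 ≤ Real.exp (4 * ρ) - 1 := by linarith [Real.add_one_le_exp (4 * ρ)]
  have hγ0 : 0 ≤ γ := (norm_nonneg _).trans (hγ z)
  have hx0 : 0 ≤ x' := (norm_nonneg _).trans (hx' z μ ν hμν)
  have h := norm_curlAt_sub_curlAt_le_of_gaugeAct hW hgu hg z μ ν (hρ₀ _ _) (hρ₀ _ _) (hρ₀ _ _) (hρ₀ _ _) (hρ₁ _ _) (hρ₁ _ _) (hρ₁ _ _) (hρ₁ _ _)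
  refine h.trans (add_le_add ?_ ?_)
  · exact mul_le_mul (mul_le_mul_of_nonneg_left (hγ z) (by norm_num)) (hx' z μ ν hμν) (norm_nonneg _) (by positivity)
  · have hs : ‖X₁ z μ - X₀ z μ‖ + ‖X₁ (z + e μ) ν - X₀ (z + e μ) ν‖ + ‖X₁ (z + e ν) μ - X₀ (z + e ν) μ‖ + ‖X₁ z ν - X₀ z ν‖ ≤ 4 * η := by
      linarith [hη z μ, hη (z + e μ) ν, hη (z + e ν) μ, hη z ν]
    calc (Real.exp (4 * ρ) - 1) * _ ≤ (Real.exp (4 * ρ) - 1) * (4 * η) := mul_le_mul_of_nonneg_left hs hexp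
      _ = 4 * (Real.exp (4 * ρ) - 1) * η := by ring

/-- **The same on indexed plaquettes `p : Plaq d`** (`curl W X p = curlAt W X p.1 p.2.1.1 p.2.1.2`, planes `μ < ν`). [folklore] -/
theorem norm_curl_sub_curl_le_of_gaugeAct_smallField [Nonempty n] {W : Site d → Fin d → (Matrix n n ℂ)ˣ} (hW : IsUnitaryCfg W) {g : Site d → (Matrix n n ℂ)ˣ}
    (hgu : IsUnitarySite g) {X₀ X₁ : Site d → Fin d → Matrix n n ℂ} (hg : vary W X₁ 1 = gaugeAct g (vary W X₀ 1)) {x' γ ρ η : ℝ}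
    (hx' : SmallField (vary W X₀ 1) x') (hγ : ∀ y, ‖((g y : (Matrix n n ℂ)ˣ) : Matrix n n ℂ) - 1‖ ≤ γ)
    (hρ₀ : ∀ y κ, ‖X₀ y κ‖ ≤ ρ) (hρ₁ : ∀ y κ, ‖X₁ y κ‖ ≤ ρ) (hη : ∀ y κ, ‖X₁ y κ - X₀ y κ‖ ≤ η) (p : T4AveragingDeficitWall.Plaq d) :
    ‖curl W X₁ p - curl W X₀ p‖ ≤ 2 * γ * x' + 4 * (Real.exp (4 * ρ) - 1) * η :=
  norm_curlAt_sub_curlAt_le_of_gaugeAct_smallField hW hgu hg hx' hγ hρ₀ hρ₁ hη p.1 (ne_of_lt p.2.2)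

end

end Summit.QuantumFields.BalabanUV.T4Continuum.NE7GaugeStepCurlCovariance
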